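import Summits.NavierStokesRegularity.NavierStokesRegularity.Theorems.TypeIIInviscidRelaxationAxisymSwirlRegularHalfLineBarrierCriterion
import Literature.Analysis.FluidPDE.NSTimeRescaleClassical
import HarnessLib

/-!
# One-sided radial-inflow criteria from time-dependent barriers: every viscosity `ν > 0`

Helper toward the crux `AxisymSwirlRegular` (stmt-NavierStokesRegularity-1964, route TypeIIInviscidRelaxation),
registered line `radial_inflow_split`, criterion side `stub_oneSidedRadialCriterion` (⟨19059⟩; its class has a
general viscosity `ν`).  The unit-viscosity criterion
`RadialInflowComparisonT.hasSmoothExtensionPast_of_timeDependentBarrier` is carried to every `ν > 0` by the TIME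
DILATION `v(s,x) = c·u(cs,x)`, `c = ν⁻¹` (viscosity `ν ↦ cν = 1`, horizon `T ↦ T/c = νT`): the gate `u_r ≥ −E(r,t)`
becomes `v_r ≥ −c·E(r, cs)`, so the barrier has to be supplied for the DILATED envelope `(r,s) ↦ ν⁻¹E(r, ν⁻¹s)` on
`(0,2) × (0, νT)`.

* `hasSmoothExtensionPast_of_timeDependentBarrier_visc` — generic envelope, any `ν > 0`.
* `hasSmoothExtensionPast_of_kappaEnvelope` — the κ-inflow envelope
  `E_{κ,M,ν,T}(r,t) = M ν^{1−κ/2} r^{κ−1}(T−t)^{−κ/2}` dilates EXACTLY to `E_{κ,M,1,νT}` (`kappaEnvelope_dilate`, the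
  reason for the factor `ν^{1−κ/2}`), so a half-line barrier for `(κ, M, νT)` gives the criterion at viscosity `ν`:
  the ideator line `kappa-inflow` (ns-idea-4) — `MixedInflowCriterion` modulo O1 `HalfLineBarrier` — is now a tree
  theorem with the barrier as its only hypothesis (O2a/O2b/O3/O5 of that line discharged here and in the two
  sibling files).

Inputs BY NAME (all discharged in the tree): `IsClassicalNSSolutionOn.timeDilate_Ico`,
`hasSmoothExtensionPast_timeDilate_iff` (`NSTimeRescaleClassical`), `IsLerayHopfOn.viscosityRescale`,
`iteratedFDeriv_const_smul_apply` (rapid decay of `c • u₀`), `rotZL` (axisymmetry is linear), `real_inner_smul_left`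
(`radialVelocity` is linear).  Ported (generic-`E` rewrite of `scaling_holds` / `inflowEnvelope_dilate`) from the
files-only κ-inflow skeleton `KappaInflow_v1_9.lean` of ns-idea-4 (2026-08-28).

References: Qi S. Zhang, arXiv:2604.07785 (2026), §3 [Zhang2026PartialTypeI]. [folklore scaling]
-/

noncomputable section

set_option linter.dupNamespace false

open Literature.Analysis.FluidPDE MeasureTheory Set Filter Topology
open scoped ENNReal NNReal RealInnerProductSpace

namespace Summit.NavierStokesRegularity.NavierStokesRegularity.Theorems.RadialInflowComparisonT

open Summit.NavierStokesRegularity.NavierStokesRegularity.Theorems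
open Summit.NavierStokesRegularity.NavierStokesRegularity.Theorems.ScenarioCensus
open Summit.NavierStokesRegularity.NavierStokesRegularity.Theorems.ScenarioCensus.LogGate
open Metric Function InnerProductSpace

/-- **The time-dependent-barrier criterion at viscosity `ν > 0`** (generic envelope). A solution of the standing
class of ⟨19059⟩ at viscosity `ν` on `[0,T)` obeying the gate `u_r ≥ −E(r,t)` on the unit tube `0 < r ≤ 1` extends
past `T` as soon as there is a half-line barrier (clauses of `abs_swirl_le_of_timeDependentBarrier`) on
`(0,2) × (0, νT)` for the dilated envelope `(r,s) ↦ ν⁻¹·E(r, ν⁻¹s)`.  Proof: time dilation `c = ν⁻¹` to viscosity `1`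
(classical / Leray–Hopf / rapid decay / sub-slab bounds / axisymmetry transport; `radialVelocity` scales by `c`),
`hasSmoothExtensionPast_of_timeDependentBarrier`, and `hasSmoothExtensionPast_timeDilate_iff` back. [folklore scaling] -/
theorem hasSmoothExtensionPast_of_timeDependentBarrier_visc {ν T α C : ℝ} {E w : ℝ → ℝ → ℝ}
    {u : ℝ → E3 → E3} {p : ℝ → E3 → ℝ} (hν : 0 < ν) (hT : 0 < T) (hα : 0 < α)
    (hC2j : ContDiffOn ℝ 2 (fun q : ℝ × ℝ => w q.1 q.2) (Ioo 0 2 ×ˢ Ioo 0 (ν * T)))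
    (hC0j : ContinuousOn (fun q : ℝ × ℝ => w q.1 q.2) (Icc 0 2 ×ˢ Ico 0 (ν * T)))
    (hsl : ∀ s ∈ Ico 0 (ν * T), w 0 s = 0 ∧ MonotoneOn (fun r => w r s) (Icc 0 2) ∧
      (∀ r ∈ Icc (0 : ℝ) 1, w r s ≤ C * r ^ α) ∧ 1 ≤ w 1 s)
    (hdat0 : ∀ r ∈ Icc (0 : ℝ) 2, min r 1 ^ 2 ≤ w r 0)
    (hpde : ∀ r ∈ Ioo (0 : ℝ) 2, ∀ s ∈ Ioo 0 (ν * T),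
      iteratedDeriv 2 (fun ρ => w ρ s) r - r⁻¹ * deriv (fun ρ => w ρ s) r
          + ν⁻¹ * E r (ν⁻¹ * s) * deriv (fun ρ => w ρ s) r ≤ deriv (fun s' => w r s') s)
    (hcl : IsClassicalNSSolutionOn (Ico 0 T) ν 0 u p) (hLH : IsLerayHopfOn T ν 0 (u 0) u)
    (hdec : HasRapidSpatialDecay (u 0))
    (hbd : ∀ T' < T, ∃ B : ℝ, ∀ t ∈ Icc 0 T', ∀ x, ‖u t x‖ ≤ B)
    (hax : ∀ t ∈ Ico 0 T, IsAxisymmetric (u t))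
    (henv : ∀ t ∈ Ico 0 T, ∀ x : E3, 0 < cylRadius x → cylRadius x ≤ 1 →
      -E (cylRadius x) t ≤ radialVelocity (u t) x) :
    HasSmoothExtensionPast ν 0 u T := by
  set c : ℝ := ν⁻¹ with hc_def
  have hc : 0 < c := inv_pos.2 hν
  have hcν : c * ν = 1 := inv_mul_cancel₀ hν.ne'
  have hTc : 0 < T / c := div_pos hT hc
  have hTc' : T / c = ν * T := by rw [hc_def, div_inv_eq_mul, mul_comm]
  have hmem : ∀ s ∈ Ico 0 (T / c), c * s ∈ Ico 0 T := by
    intro s hs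
    refine ⟨mul_nonneg hc.le hs.1, ?_⟩
    have := (lt_div_iff₀ hc).1 hs.2
    linarith [mul_comm s c]
  -- (1) classical on [0, T/c) at viscosity 1
  have hcl' : IsClassicalNSSolutionOn (Ico 0 (T / c)) 1 0 (timeRescale c c u) (timeRescale c (c ^ 2) p) := by
    have := hcl.timeDilate_Ico hc
    rwa [hcν, timeRescale_zero_force] at this
  -- (2) Leray–Hopf
  have h0 : timeRescale c c u 0 = c • u 0 := by
    funext x; simp
  have hLH' : IsLerayHopfOn (T / c) 1 0 (timeRescale c c u 0) (timeRescale c c u) := by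
    have := hLH.viscosityRescale hc
    rwa [hcν, timeRescale_zero_force, ← h0] at this
  -- (3) rapid decay of the datum
  have hdec' : HasRapidSpatialDecay (timeRescale c c u 0) := by
    rw [h0]
    have hsm := hcl.contDiff_velocity (t := 0) ⟨le_rfl, hT⟩
    intro n K
    obtain ⟨C₀, hC₀⟩ := hdec n K
    refine ⟨|c| * C₀, fun x => ?_⟩
    have hn : ContDiffAt ℝ n (u 0) x := (hsm.of_le (by exact_mod_cast le_top)).contDiffAt
    rw [iteratedFDeriv_const_smul_apply hn, norm_smul, Real.norm_eq_abs]
    calc (1 + ‖x‖) ^ K * (|c| * ‖iteratedFDeriv ℝ n (u 0) x‖)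
        = |c| * ((1 + ‖x‖) ^ K * ‖iteratedFDeriv ℝ n (u 0) x‖) := by ring
      _ ≤ |c| * C₀ := mul_le_mul_of_nonneg_left (hC₀ x) (abs_nonneg c)
  -- (4) bounded on closed sub-slabs
  have hbd' : ∀ T' < T / c, ∃ B : ℝ, ∀ s ∈ Icc 0 T', ∀ x, ‖timeRescale c c u s x‖ ≤ B := by
    intro T' hT'
    have hcT' : c * T' < T := by
      have := (lt_div_iff₀ hc).1 hT'
      linarith [mul_comm T' c]
    obtain ⟨B, hB⟩ := hbd (c * T') hcT'
    refine ⟨c * B, fun s hs x => ?_⟩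
    have hcs : c * s ∈ Icc 0 (c * T') :=
      ⟨mul_nonneg hc.le hs.1, mul_le_mul_of_nonneg_left hs.2 hc.le⟩
    rw [timeRescale_apply, norm_smul, Real.norm_eq_abs, abs_of_pos hc]
    exact mul_le_mul_of_nonneg_left (hB _ hcs x) hc.le
  -- (5) axisymmetric slices
  have hax' : ∀ s ∈ Ico 0 (T / c), IsAxisymmetric (timeRescale c c u s) := by
    intro s hs θ x
    rw [timeRescale_apply, timeRescale_apply, hax _ (hmem s hs) θ x,
      show rotZ θ (c • u (c * s) x) = rotZL θ (c • u (c * s) x) from rfl, map_smul, rotZL_apply]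
  -- (6) the gate transports: `v_r ≥ −c·E(r, cs)`
  have henv' : ∀ s ∈ Ico 0 (T / c), ∀ x : E3, 0 < cylRadius x → cylRadius x ≤ 1 →
      -((fun r s => c * E r (c * s)) (cylRadius x) s) ≤ radialVelocity (timeRescale c c u s) x := by
    intro s hs x hx hx1
    have h1 := henv (c * s) (hmem s hs) x hx hx1
    have hrad : radialVelocity (timeRescale c c u s) x = c * radialVelocity (u (c * s)) x := by
      simp only [radialVelocity, timeRescale_apply, real_inner_smul_left]
    rw [hrad]
    have := mul_le_mul_of_nonneg_left h1 hc.le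
    rw [mul_neg] at this
    exact this
  -- the barrier hypotheses, read on `(0, T/c) = (0, νT)`
  rw [← hTc'] at hC2j hC0j hsl hpde
  -- apply the unit-viscosity criterion and dilate back
  have hext := hasSmoothExtensionPast_of_timeDependentBarrier (E := fun r s => c * E r (c * s)) hTc hα hC2j
    hC0j hsl hdat0 hpde hcl' hLH' hdec' hbd' hax' henv'
  have key := hasSmoothExtensionPast_timeDilate_iff (f := (0 : ℝ → E3 → E3)) (u := u) (T := T) (ν := ν) hc
  rw [hcν, timeRescale_zero_force] at key
  exact key.1 hext

/-- **The κ-envelope dilates exactly**: for `s < νT`,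
`ν⁻¹ · E_{κ,M,ν,T}(r, ν⁻¹s) = M r^{κ−1} (νT − s)^{−κ/2} = E_{κ,M,1,νT}(r, s)` — the reason for the factor `ν^{1−κ/2}`
in the κ-inflow envelope `E_{κ,M,ν,T}(r,t) = M ν^{1−κ/2} r^{κ−1}(T−t)^{−κ/2}`. [folklore] -/
theorem kappaEnvelope_dilate {κ M ν T r s : ℝ} (hν : 0 < ν) (hs : ν⁻¹ * s < T) :
    ν⁻¹ * (M * ν ^ (1 - κ / 2) * r ^ (κ - 1) * (T - ν⁻¹ * s) ^ (-(κ / 2)))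
      = M * r ^ (κ - 1) * (ν * T - s) ^ (-(κ / 2)) := by
  have hpos : 0 ≤ T - ν⁻¹ * s := by linarith
  have h1 : ν * T - s = ν * (T - ν⁻¹ * s) := by
    field_simp
  have h2 : ν⁻¹ * ν ^ (1 - κ / 2) = ν ^ (-(κ / 2)) := by
    rw [← Real.rpow_neg_one, ← Real.rpow_add hν]; congr 1; ring
  rw [h1, Real.mul_rpow hν.le hpos]
  calc ν⁻¹ * (M * ν ^ (1 - κ / 2) * r ^ (κ - 1) * (T - ν⁻¹ * s) ^ (-(κ / 2)))
      = M * (ν⁻¹ * ν ^ (1 - κ / 2)) * r ^ (κ - 1) * (T - ν⁻¹ * s) ^ (-(κ / 2)) := by ring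
    _ = M * r ^ (κ - 1) * (ν ^ (-(κ / 2)) * (T - ν⁻¹ * s) ^ (-(κ / 2))) := by rw [h2]; ring

/-- **The κ-inflow criterion at every viscosity, modulo its 1D barrier** (= the ideator line's
`MixedInflowCriterion` with O1 `HalfLineBarrierAt κ M (νT)` as the ONLY hypothesis, spelled out as `hB`; for any
`κ, M`). A solution of the standing class at viscosity `ν` on `[0,T)` with
`u_r ≥ −M ν^{1−κ/2} r^{κ−1}(T−t)^{−κ/2}` on the unit tube extends past `T` if the half-line barrier for
`(κ, M, νT)` exists. [new; conditional on the barrier hypothesis `hB`] -/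
theorem hasSmoothExtensionPast_of_kappaEnvelope {κ M ν T : ℝ} {u : ℝ → E3 → E3} {p : ℝ → E3 → ℝ}
    (hν : 0 < ν) (hT : 0 < T)
    (hB : ∃ (α C : ℝ) (w : ℝ → ℝ → ℝ), 0 < α ∧ α ≤ 1 ∧ 0 < C ∧
      ContDiffOn ℝ 2 (fun q : ℝ × ℝ => w q.1 q.2) (Ioo 0 2 ×ˢ Ioo 0 (ν * T)) ∧
      ContinuousOn (fun q : ℝ × ℝ => w q.1 q.2) (Icc 0 2 ×ˢ Ico 0 (ν * T)) ∧
      (∀ s ∈ Ico 0 (ν * T), w 0 s = 0 ∧ MonotoneOn (fun r => w r s) (Icc 0 2) ∧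
        (∀ r ∈ Icc (0 : ℝ) 1, w r s ≤ C * r ^ α) ∧ 1 ≤ w 1 s) ∧
      (∀ r ∈ Icc (0 : ℝ) 2, min r 1 ^ 2 ≤ w r 0) ∧
      (∀ r ∈ Ioo (0 : ℝ) 2, ∀ s ∈ Ioo 0 (ν * T),
        iteratedDeriv 2 (fun ρ => w ρ s) r - r⁻¹ * deriv (fun ρ => w ρ s) r
            + M * r ^ (κ - 1) * (ν * T - s) ^ (-(κ / 2)) * deriv (fun ρ => w ρ s) r
          ≤ deriv (fun s' => w r s') s))
    (hcl : IsClassicalNSSolutionOn (Ico 0 T) ν 0 u p) (hLH : IsLerayHopfOn T ν 0 (u 0) u)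
    (hdec : HasRapidSpatialDecay (u 0))
    (hbd : ∀ T' < T, ∃ B : ℝ, ∀ t ∈ Icc 0 T', ∀ x, ‖u t x‖ ≤ B)
    (hax : ∀ t ∈ Ico 0 T, IsAxisymmetric (u t))
    (henv : ∀ t ∈ Ico 0 T, ∀ x : E3, 0 < cylRadius x → cylRadius x ≤ 1 →
      -(M * ν ^ (1 - κ / 2) * cylRadius x ^ (κ - 1) * (T - t) ^ (-(κ / 2))) ≤ radialVelocity (u t) x) :
    HasSmoothExtensionPast ν 0 u T := by
  obtain ⟨α, C, w, hα, -, -, hC2j, hC0j, hsl, hdat0, hpde⟩ := hB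
  refine hasSmoothExtensionPast_of_timeDependentBarrier_visc
    (E := fun r t => M * ν ^ (1 - κ / 2) * r ^ (κ - 1) * (T - t) ^ (-(κ / 2))) hν hT hα hC2j hC0j hsl hdat0
    (fun r hr s hs => ?_) hcl hLH hdec hbd hax henv
  have hsT : ν⁻¹ * s < T := by
    rw [inv_mul_lt_iff₀ hν]
    exact hs.2
  have e := kappaEnvelope_dilate (κ := κ) (M := M) (r := r) hν hsT
  simp only [e]
  exact hpde r hr s hs

end Summit.NavierStokesRegularity.NavierStokesRegularity.Theorems.RadialInflowComparisonT

end
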